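import Summits.HodgeConjecture.HodgeConjecture.Theorems.NikulinTwinTransportRealMultiplicationFibreIntegral
import Literature.AlgebraicGeometry.HodgeTheory.GysinBaseChange
import Literature.AlgebraicGeometry.Surfaces.K3HodgeTypesProofs

/-!
# Route NikulinTwinTransport · `RealMultiplicationSqrtTwoAlgebraic` (stmt-HodgeConjecture-13679) —
# the item modulo X and three NAMED facts

`realMultiplicationSqrtTwoAlgebraic_of_kunneth` (file
`NikulinTwinTransportRealMultiplicationFibreIntegral`) derives the route decl from X =
`TwinSimilitudeAlgebraic`, the named facts `Huybrechts_K3_marking_exists`,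
`Huybrechts_K3_hodgeTypes_H2`, `Grothendieck1969_supportedClasses_le_hodgeConiveau`, and ONE
hypothesis spelled inline: the spanning half of the Künneth formula for the complex points of a
product of two smooth projective complex varieties (the hypothesis `hK` of
`Literature.AlgebraicGeometry.HodgeTheory.gysin_baseChange_of_kunneth`). That hypothesis is now a
THEOREM of the tree — `Literature.AlgebraicGeometry.HodgeTheory.kunnethSpan_complexBetti` (file
`HodgeTheory/GysinBaseChange`: the Künneth formula `LerayHirsch.kunneth_mem_span_of_field` of
`AlgebraicTopology/SingularHomology/KunnethFormula`, Hatcher Thm. 3.15/3.16 through the tree's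
Leray–Hirsch engine, transported along `(Y ⊗ Z)(ℂ) ≃ₜ Y(ℂ) × Z(ℂ)`) — so it is discharged here:

* `realMultiplicationSqrtTwoAlgebraic_of_facts` — THE ITEM from X + the three named facts, no
  other hypothesis: real multiplication by `√2` on a projective K3 surface is algebraic granted
  X = Sim₂(K3) at the pair `(S, S)`, markings of K3 surfaces, the Hodge types of `H²(K3)` and
  Grothendieck's `Nᵖ ⊆ Hodge coniveau p`;
* `realMultiplicationGlue_of_facts` — the glue item `RealMultiplicationGlue`
  (stmt-HodgeConjecture-13681) from the three named facts ALONE;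
* `assembly_of_squareGlue_of_facts` — the frame item `Assembly` (stmt-HodgeConjecture-13942) from
  `SquareGlue` + the three named facts;
* `realMultiplicationSqrtTwoAlgebraic_of_marking_deRham`, `realMultiplicationGlue_of_marking_deRham`
  — the same with `Huybrechts_K3_hodgeTypes_H2` replaced by DE RHAM'S THEOREM
  (`Literature.NumberTheory.Transcendental.exists_deRhamIsoFamily` on finite-dimensional complex
  model spaces), through the tree's `Huybrechts_K3_hodgeTypes_H2_of_marking_of_exists_deRhamIsoFamily`:
  trust base {markings of K3 surfaces, de Rham's theorem, Grothendieck's coniveau inclusion} (+ X).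

Prover seat prover-pitem-stmt-HodgeConjecture-13679-0.

## References

* [Varesco2023] M. Varesco, Math. Z. 305 (2023), Thm. 2.1, Rem. 2.2.
* [HatcherAT2002] A. Hatcher, Algebraic Topology, CUP 2002, §3.2 Thm. 3.15–3.16.
* [Huybrechts2016K3] D. Huybrechts, Lectures on K3 Surfaces, CUP 2016, Ch. 1 Prop. 3.5, Ch. 6 Prop. 1.2.
* [WarnerGTM94] F. Warner, Foundations of Differentiable Manifolds and Lie Groups, GTM 94, Thm. 5.36, 5.45.
-/

noncomputable section

namespace Summit.HodgeConjecture.HodgeConjecture.Theorems.NikulinTwinTransport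

open scoped Manifold
open Literature.AlgebraicGeometry.HodgeTheory Literature.AlgebraicGeometry.Surfaces
open Literature.NumberTheory.Transcendental (exists_deRhamIsoFamily)

/-- **Real multiplication by `√2` on projective K3 surfaces is algebraic, granted X = Sim₂(K3) and
three NAMED facts** (markings of K3 surfaces, Hodge types of `H²(K3)`, Grothendieck's
`Nᵖ ⊆ Hodge coniveau p`): the item stmt-HodgeConjecture-13679 with no inline formal debt — the
Künneth spanning hypothesis of `realMultiplicationSqrtTwoAlgebraic_of_kunneth` is the tree's theorem
`kunnethSpan_complexBetti`. [cite: Varesco2023, Thm. 2.1 and Rem. 2.2]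
[cite: HatcherAT2002, §3.2 Thm. 3.15] -/
theorem realMultiplicationSqrtTwoAlgebraic_of_facts
    (hX : Theses.NikulinTwinTransport.TwinSimilitudeAlgebraic)
    (hmark : Huybrechts_K3_marking_exists) (hHT : Huybrechts_K3_hodgeTypes_H2)
    (hG : Grothendieck1969_supportedClasses_le_hodgeConiveau) :
    Theses.NikulinTwinTransport.RealMultiplicationSqrtTwoAlgebraic :=
  realMultiplicationSqrtTwoAlgebraic_of_kunneth hX hmark hHT hG
    (fun _ _ _ _ hY hZ => kunnethSpan_complexBetti hY hZ)

/-- **The glue item `RealMultiplicationGlue` (stmt-HodgeConjecture-13681) from three NAMED facts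
alone** (`TwinSimilitudeAlgebraic → HodgeIsometryAlgebraic → TwinExists → LefschetzOneOneK3 →
RealMultiplicationSqrtTwoAlgebraic`; of its hypotheses only X is used — no Buskin, no universal twin,
no Lefschetz `(1,1)`). [cite: Varesco2023, Thm. 2.1 and Rem. 2.2] [cite: HatcherAT2002, §3.2 Thm. 3.15] -/
theorem realMultiplicationGlue_of_facts
    (hmark : Huybrechts_K3_marking_exists) (hHT : Huybrechts_K3_hodgeTypes_H2)
    (hG : Grothendieck1969_supportedClasses_le_hodgeConiveau) :
    Theses.NikulinTwinTransport.RealMultiplicationGlue :=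
  realMultiplicationGlue_of_kunneth hmark hHT hG (fun _ _ _ _ hY hZ => kunnethSpan_complexBetti hY hZ)

/-- **The frame item `Assembly` (stmt-HodgeConjecture-13942) from `SquareGlue` and three NAMED
facts** (of its hypotheses only X, Lefschetz `(1,1)` — consumed by `SquareGlue` — and the sector
complement are used). [cite: Varesco2023, Thm. 2.1 and Rem. 2.2] [cite: HatcherAT2002, §3.2 Thm. 3.15] -/
theorem assembly_of_squareGlue_of_facts
    (hSq : Theses.NikulinTwinTransport.SquareGlue)
    (hmark : Huybrechts_K3_marking_exists) (hHT : Huybrechts_K3_hodgeTypes_H2)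
    (hG : Grothendieck1969_supportedClasses_le_hodgeConiveau) :
    Theses.NikulinTwinTransport.Assembly :=
  assembly_of_squareGlue_of_kunneth hSq hmark hHT hG (fun _ _ _ _ hY hZ => kunnethSpan_complexBetti hY hZ)

/-- **The item from X, markings, DE RHAM'S THEOREM and Grothendieck's coniveau inclusion**: the
Hodge-type fact `Huybrechts_K3_hodgeTypes_H2` is supplied by the marking fact and de Rham's theorem
(`Huybrechts_K3_hodgeTypes_H2_of_marking_of_exists_deRhamIsoFamily`).
[cite: Varesco2023, Thm. 2.1 and Rem. 2.2] [cite: WarnerGTM94, Thm. 5.36 / Thm. 5.45] -/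
theorem realMultiplicationSqrtTwoAlgebraic_of_marking_deRham
    (hX : Theses.NikulinTwinTransport.TwinSimilitudeAlgebraic)
    (hmark : Huybrechts_K3_marking_exists)
    (hdR : ∀ (E : Type) [NormedAddCommGroup E] [NormedSpace ℂ E] [FiniteDimensional ℂ E],
      exists_deRhamIsoFamily 𝓘(ℝ, E))
    (hG : Grothendieck1969_supportedClasses_le_hodgeConiveau) :
    Theses.NikulinTwinTransport.RealMultiplicationSqrtTwoAlgebraic :=
  realMultiplicationSqrtTwoAlgebraic_of_facts hX hmark
    (Huybrechts_K3_hodgeTypes_H2_of_marking_of_exists_deRhamIsoFamily hmark hdR) hG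

/-- **The glue item `RealMultiplicationGlue` (stmt-HodgeConjecture-13681) from markings, DE RHAM'S
THEOREM and Grothendieck's coniveau inclusion alone.**
[cite: Varesco2023, Thm. 2.1 and Rem. 2.2] [cite: WarnerGTM94, Thm. 5.36 / Thm. 5.45] -/
theorem realMultiplicationGlue_of_marking_deRham
    (hmark : Huybrechts_K3_marking_exists)
    (hdR : ∀ (E : Type) [NormedAddCommGroup E] [NormedSpace ℂ E] [FiniteDimensional ℂ E],
      exists_deRhamIsoFamily 𝓘(ℝ, E))
    (hG : Grothendieck1969_supportedClasses_le_hodgeConiveau) :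
    Theses.NikulinTwinTransport.RealMultiplicationGlue :=
  realMultiplicationGlue_of_facts hmark
    (Huybrechts_K3_hodgeTypes_H2_of_marking_of_exists_deRhamIsoFamily hmark hdR) hG

end Summit.HodgeConjecture.HodgeConjecture.Theorems.NikulinTwinTransport

end
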